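import Mathlib.MeasureTheory.Measure.Lebesgue.Integral
import Mathlib.Analysis.SpecialFunctions.Integrals.Basic
import HarnessLib

/-!
# Area of the slice hexagons `α Δ + β (−Δ)` (helper for stub `stub_sliceDomination` of the crux
# `StackingLiminf`, stmt-Ventures-19145, line `LayerChain`)

Route `StickyWulffConstant` of the venture `Summits/Ventures/Crystal3D` (cell `crystal3d-full`).

Every horizontal section of a homogenised stacking Wulff body `W_f` (line `LayerChain`, Step 2) is a
hexagon `α Δ + β (−Δ)`, `Δ = conv{ℓ₁, ℓ₂, ℓ₃}` the unit triangle of the hexagonal frame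
(`ℓ₁ = (½, √3/6)`, `ℓ₂ = (−½, √3/6)`, `ℓ₃ = (0, −√3/3)`), i.e. the hexagon with alternating side lengths
`α, β` and horizontal top/bottom edges.  In FIBRED form (over the second coordinate `w = x₂`) it is
`lo < w < hi`, `|x₁| < U(w)` with
`lo = −(2α+β)√3/6`, `hi = (α+2β)√3/6`, `U(w) = min((2α+β)/3 − w√3/3, (α+2β)/3 + w√3/3)`.
This file proves the AREA FORMULA `|α Δ + β (−Δ)| = (√3/4)(α² + 4αβ + β²)` for the open fibred hexagon
(`volume_sliceHexagon_open`, via `volume_regionBetween_eq_integral` after swapping the coordinates and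
one split of the fibre integral at the kink `w* = (α−β)√3/6`) and the same UPPER BOUND for the closed
one (`volume_sliceHexagon_closed_le`, by shrinking `closed(α,β) ⊆ open(α+δ,β+δ)` and `δ → 0`).
Pure planar measure theory; no stacking objects.  WHAT THIS IS NOT: anything about `W_f`; rung F-C1 not
moved.
-/

noncomputable section

namespace Summit.Ventures.Crystal3D.Theorems

open MeasureTheory Set Filter Topology

/-- The fibre integral of the width `2U(w)` of the slice hexagon over `(lo, hi)`:
`∫ 2U = (√3/4)(α² + 4αβ + β²)`. -/
theorem integral_sliceHexagon_width (α β : ℝ) (hα : 0 ≤ α) (hβ : 0 ≤ β) :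
    ∫ w in -((2 * α + β) * Real.sqrt 3 / 6)..((α + 2 * β) * Real.sqrt 3 / 6),
      (min ((2 * α + β) / 3 - w * Real.sqrt 3 / 3) ((α + 2 * β) / 3 + w * Real.sqrt 3 / 3) -
        -min ((2 * α + β) / 3 - w * Real.sqrt 3 / 3) ((α + 2 * β) / 3 + w * Real.sqrt 3 / 3)) =
      Real.sqrt 3 / 4 * (α ^ 2 + 4 * α * β + β ^ 2) := by
  set s3 := Real.sqrt 3 with hs3
  have h3 : s3 * s3 = 3 := Real.mul_self_sqrt (by norm_num)
  have hs3pos : 0 < s3 := Real.sqrt_pos.2 (by norm_num)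
  set lo := -((2 * α + β) * s3 / 6) with hlo
  set hi := (α + 2 * β) * s3 / 6 with hhi
  set ws := (α - β) * s3 / 6 with hws
  have hlo_ws : lo ≤ ws := by rw [hlo, hws]; nlinarith
  have hws_hi : ws ≤ hi := by rw [hhi, hws]; nlinarith
  set U : ℝ → ℝ := fun w => min ((2 * α + β) / 3 - w * s3 / 3) ((α + 2 * β) / 3 + w * s3 / 3)
    with hU
  have hcont : Continuous U := by rw [hU]; fun_prop
  have hint : ∀ a b : ℝ, IntervalIntegrable (fun w => U w - -U w) volume a b := fun a b =>
    (hcont.sub hcont.neg).intervalIntegrable a b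
  show ∫ w in lo..hi, (U w - -U w) = s3 / 4 * (α ^ 2 + 4 * α * β + β ^ 2)
  rw [← intervalIntegral.integral_add_adjacent_intervals (hint lo ws) (hint ws hi)]
  -- lower piece: `U` is the second branch
  have h1 : ∫ w in lo..ws, (U w - -U w) =
      ∫ w in lo..ws, (2 * ((α + 2 * β) / 3) + (2 * s3 / 3) * w) := by
    apply intervalIntegral.integral_congr
    intro w hw
    rw [uIcc_of_le hlo_ws] at hw
    have hle : (α + 2 * β) / 3 + w * s3 / 3 ≤ (2 * α + β) / 3 - w * s3 / 3 := by
      have h := hw.2; rw [hws] at h; nlinarith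
    simp only [hU, min_eq_right hle]; ring
  -- upper piece: `U` is the first branch
  have h2 : ∫ w in ws..hi, (U w - -U w) =
      ∫ w in ws..hi, (2 * ((2 * α + β) / 3) + (-(2 * s3 / 3)) * w) := by
    apply intervalIntegral.integral_congr
    intro w hw
    rw [uIcc_of_le hws_hi] at hw
    have hle : (2 * α + β) / 3 - w * s3 / 3 ≤ (α + 2 * β) / 3 + w * s3 / 3 := by
      have h := hw.1; rw [hws] at h; nlinarith
    simp only [hU, min_eq_left hle]; ring
  have hlin : ∀ (a b c d : ℝ), ∫ w in a..b, (c + d * w) = (b - a) * c + d * ((b ^ 2 - a ^ 2) / 2) := by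
    intro a b c d
    rw [intervalIntegral.integral_add intervalIntegrable_const
      ((by fun_prop : Continuous fun w : ℝ => d * w).intervalIntegrable a b),
      intervalIntegral.integral_const, intervalIntegral.integral_const_mul, integral_id, smul_eq_mul]
  rw [h1, h2, hlin, hlin, hlo, hhi, hws]
  linear_combination (-(s3 * (α ^ 2 + 4 * α * β + β ^ 2) / 36)) * h3

/-- **Area of the open slice hexagon** `α Δ + β (−Δ)` in fibred form:
`|{lo < x₂ < hi, |x₁| < U(x₂)}| = (√3/4)(α² + 4αβ + β²)` (`α, β ≥ 0`). -/
theorem volume_sliceHexagon_open (α β : ℝ) (hα : 0 ≤ α) (hβ : 0 ≤ β) :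
    volume {p : ℝ × ℝ | -((2 * α + β) * Real.sqrt 3 / 6) < p.2 ∧ p.2 < (α + 2 * β) * Real.sqrt 3 / 6 ∧
        -min ((2 * α + β) / 3 - p.2 * Real.sqrt 3 / 3) ((α + 2 * β) / 3 + p.2 * Real.sqrt 3 / 3) < p.1 ∧
        p.1 < min ((2 * α + β) / 3 - p.2 * Real.sqrt 3 / 3) ((α + 2 * β) / 3 + p.2 * Real.sqrt 3 / 3)} =
      ENNReal.ofReal (Real.sqrt 3 / 4 * (α ^ 2 + 4 * α * β + β ^ 2)) := by
  set s3 := Real.sqrt 3 with hs3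
  have hs3pos : 0 < s3 := Real.sqrt_pos.2 (by norm_num)
  set lo := -((2 * α + β) * s3 / 6) with hlo
  set hi := (α + 2 * β) * s3 / 6 with hhi
  have hlohi : lo ≤ hi := by rw [hlo, hhi]; nlinarith
  set U : ℝ → ℝ := fun w => min ((2 * α + β) / 3 - w * s3 / 3) ((α + 2 * β) / 3 + w * s3 / 3)
    with hU
  have hcont : Continuous U := by rw [hU]; fun_prop
  have hset : {p : ℝ × ℝ | lo < p.2 ∧ p.2 < hi ∧ -U p.2 < p.1 ∧ p.1 < U p.2} =
      Prod.swap ⁻¹' regionBetween (-U) U (Ioo lo hi) := by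
    ext p
    simp only [mem_setOf_eq, mem_preimage, regionBetween, Prod.fst_swap, Prod.snd_swap, mem_Ioo,
      Pi.neg_apply]
    tauto
  show volume {p : ℝ × ℝ | lo < p.2 ∧ p.2 < hi ∧ -U p.2 < p.1 ∧ p.1 < U p.2} = _
  rw [hset, Measure.volume_eq_prod,
    (Measure.measurePreserving_swap).measure_preimage
      (measurableSet_regionBetween hcont.neg.measurable hcont.measurable
        measurableSet_Ioo).nullMeasurableSet]
  have h3 : s3 * s3 = 3 := Real.mul_self_sqrt (by norm_num)
  have hU_nonneg : ∀ w ∈ Ioo lo hi, -U w ≤ U w := by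
    intro w hw
    have h1 : 0 ≤ (2 * α + β) / 3 - w * s3 / 3 := by
      have := hw.2; rw [hhi] at this
      nlinarith [mul_lt_mul_of_pos_right this hs3pos, h3]
    have h2 : 0 ≤ (α + 2 * β) / 3 + w * s3 / 3 := by
      have := hw.1; rw [hlo] at this
      nlinarith [mul_lt_mul_of_pos_right this hs3pos, h3]
    have : 0 ≤ U w := le_min h1 h2
    linarith
  rw [volume_regionBetween_eq_integral
    ((hcont.neg.integrableOn_Icc).mono_set Ioo_subset_Icc_self)
    ((hcont.integrableOn_Icc).mono_set Ioo_subset_Icc_self) measurableSet_Ioo hU_nonneg]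
  congr 1
  rw [← integral_Ioc_eq_integral_Ioo, ← intervalIntegral.integral_of_le hlohi]
  simp only [Pi.sub_apply, Pi.neg_apply]
  rw [hlo, hhi, hU]
  exact integral_sliceHexagon_width α β hα hβ

/-- **Upper bound for the closed slice hexagon**: `|{lo ≤ x₂ ≤ hi, |x₁| ≤ U(x₂)}| ≤ (√3/4)(α²+4αβ+β²)`
(`α, β ≥ 0`; in fact equality).  Proof: `closed(α, β) ⊆ open(α + δ, β + δ)` for every `δ > 0`
(all three bounds move outward by a positive amount), then `δ → 0`. -/
theorem volume_sliceHexagon_closed_le (α β : ℝ) (hα : 0 ≤ α) (hβ : 0 ≤ β) :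
    volume {p : ℝ × ℝ | -((2 * α + β) * Real.sqrt 3 / 6) ≤ p.2 ∧ p.2 ≤ (α + 2 * β) * Real.sqrt 3 / 6 ∧
        -min ((2 * α + β) / 3 - p.2 * Real.sqrt 3 / 3) ((α + 2 * β) / 3 + p.2 * Real.sqrt 3 / 3) ≤ p.1 ∧
        p.1 ≤ min ((2 * α + β) / 3 - p.2 * Real.sqrt 3 / 3) ((α + 2 * β) / 3 + p.2 * Real.sqrt 3 / 3)} ≤
      ENNReal.ofReal (Real.sqrt 3 / 4 * (α ^ 2 + 4 * α * β + β ^ 2)) := by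
  set s3 := Real.sqrt 3 with hs3
  have hs3pos : 0 < s3 := Real.sqrt_pos.2 (by norm_num)
  set C := {p : ℝ × ℝ | -((2 * α + β) * s3 / 6) ≤ p.2 ∧ p.2 ≤ (α + 2 * β) * s3 / 6 ∧
        -min ((2 * α + β) / 3 - p.2 * s3 / 3) ((α + 2 * β) / 3 + p.2 * s3 / 3) ≤ p.1 ∧
        p.1 ≤ min ((2 * α + β) / 3 - p.2 * s3 / 3) ((α + 2 * β) / 3 + p.2 * s3 / 3)} with hC
  -- the area function is continuous in `δ`
  set A : ℝ → ℝ := fun δ => s3 / 4 * ((α + δ) ^ 2 + 4 * (α + δ) * (β + δ) + (β + δ) ^ 2) with hA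
  have hAcont : Continuous A := by rw [hA]; fun_prop
  have hA0 : A 0 = s3 / 4 * (α ^ 2 + 4 * α * β + β ^ 2) := by simp only [hA]; ring
  have hlim : Tendsto (fun δ => ENNReal.ofReal (A δ)) (𝓝[>] 0)
      (𝓝 (ENNReal.ofReal (s3 / 4 * (α ^ 2 + 4 * α * β + β ^ 2)))) := by
    rw [← hA0]
    exact (ENNReal.tendsto_ofReal (hAcont.tendsto 0)).mono_left nhdsWithin_le_nhds
  refine ge_of_tendsto hlim (eventually_nhdsWithin_of_forall fun δ (hδ : 0 < δ) => ?_)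
  -- `closed(α, β) ⊆ open(α + δ, β + δ)`
  have hsub : C ⊆ {p : ℝ × ℝ | -((2 * (α + δ) + (β + δ)) * Real.sqrt 3 / 6) < p.2 ∧
      p.2 < ((α + δ) + 2 * (β + δ)) * Real.sqrt 3 / 6 ∧
      -min ((2 * (α + δ) + (β + δ)) / 3 - p.2 * Real.sqrt 3 / 3)
          (((α + δ) + 2 * (β + δ)) / 3 + p.2 * Real.sqrt 3 / 3) < p.1 ∧
      p.1 < min ((2 * (α + δ) + (β + δ)) / 3 - p.2 * Real.sqrt 3 / 3)
          (((α + δ) + 2 * (β + δ)) / 3 + p.2 * Real.sqrt 3 / 3)} := by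
    rintro ⟨x, w⟩ ⟨h1, h2, h3, h4⟩
    simp only [mem_setOf_eq] at h1 h2 h3 h4 ⊢
    have hmin : min ((2 * (α + δ) + (β + δ)) / 3 - w * Real.sqrt 3 / 3)
        (((α + δ) + 2 * (β + δ)) / 3 + w * Real.sqrt 3 / 3) =
        min ((2 * α + β) / 3 - w * s3 / 3) ((α + 2 * β) / 3 + w * s3 / 3) + δ := by
      rw [← min_add_add_right]; congr 1 <;> ring
    rw [hmin]
    refine ⟨?_, ?_, ?_, ?_⟩
    · have : -((2 * (α + δ) + (β + δ)) * Real.sqrt 3 / 6) = -((2 * α + β) * s3 / 6) - δ * s3 / 2 := by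
        ring
      rw [this]; nlinarith
    · have : ((α + δ) + 2 * (β + δ)) * Real.sqrt 3 / 6 = (α + 2 * β) * s3 / 6 + δ * s3 / 2 := by ring
      rw [this]; nlinarith
    · linarith
    · linarith
  calc volume C ≤ volume _ := measure_mono hsub
    _ = ENNReal.ofReal (A δ) := by
        rw [volume_sliceHexagon_open (α + δ) (β + δ) (by linarith) (by linarith)]

end Summit.Ventures.Crystal3D.Theorems
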